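import Summits.AtomisticToContinuum.Crystallization.Theses.SquareWellLayerCake
import Summits.AtomisticToContinuum.Crystallization.Theorems.PhononSlackCertificatesPeriodicGivenLayeredLayerCake1

/-!
# `stub_uniformSpacing` of crux `GapTwelveToBarlow` (stmt-AtomisticToContinuum-15807), line `Sketch`:
# the deterministic TRANSFER (relaxed layered template with near-uniform heights ⇒ Barlow template)

Wave-2 worker file (helper; it does NOT prove the registered stub).  The stub says "ground states +
a.e. all-Good balls + a.e. RELAXED-layered-matched windows ⇒ a.e. windows matched to a UNIFORM-gap
Barlow template `barlowStacking a h s`"; its content splits into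
* a DETERMINISTIC transfer, proved here without minimality: a window matched at `(R + 1, ε/2)` to a
  relaxed layered template `{i u + j v + L_s(m) w + z(m) e₃}` whose heights are `ε/2`-close to an
  arithmetic progression on the layers `|m - m₀| ≤ 2(R+1)` is matched at `(R, ε)` to
  `barlowStacking a h s` (`barlowMatched_of_nearUniform`, `nearUniform_imp_barlowMatched`,
  a.e. form `tendsto_barlowMatched_of_nearUniform`, registered closed form
  `stub_nearUniformTransfer`); with EXACTLY arithmetic heights the relaxed template IS a translate
  of `barlowStacking a h s` (`layeredPos_uniform`, `layeredSet_uniform_eq`, `barlowMatched_of_uniform`);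
* an ENERGETIC residual (a.e. NEAR-UNIFORM GAPS at every precision; not proved, not an item today),
  from which the registered signature follows in two lines (skeleton `Lines/Sketch.lean`).
`abs_sub_arith_le_of_increments` is the interface to increment convexity.  Tree vocabulary only; the
one abbreviation is the template point `layeredPos a s z m i j := i u(a) + j v(a) + L_s(m) w(a) + z(m) e₃`.
-/

noncomputable section

namespace Summit.AtomisticToContinuum.Crystallization.Theorems.SquareWellLayerCakeGapTwelveToBarlow

open Literature.MathematicalPhysics.StatisticalMechanics

/-! ## §1 The relaxed layered template versus the Barlow template -/

/-- The RELAXED LAYERED template point (format of `HullMinimality.LayeredWindows`, stmt-11778):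
`i u + j v + (haggLabel s m) w + z m · e₃`. -/
def layeredPos (a : ℝ) (s : ℤ → ℤ) (z : ℤ → ℝ) (m i j : ℤ) : EuclideanSpace ℝ (Fin 3) :=
  (i : ℝ) • triangularVec₁ a + (j : ℝ) • triangularVec₂ a +
    (haggLabel s m : ℝ) • barlowOffset a + z m • layerNormal 1

/-- `‖layerNormal t‖ = |t|`. -/
theorem norm_layerNormal (t : ℝ) : ‖layerNormal t‖ = |t| := by
  rw [EuclideanSpace.norm_eq, Fin.sum_univ_three]
  simp [layerNormal, Real.sqrt_sq_eq_abs]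

/-- Third coordinate of a template point: its height `z m`. -/
@[simp] theorem layeredPos_apply_two (a : ℝ) (s : ℤ → ℤ) (z : ℤ → ℝ) (m i j : ℤ) :
    layeredPos a s z m i j 2 = z m := by
  simp [layeredPos, layerNormal, triangularVec₁, triangularVec₂, barlowOffset]

/-- **Uniform heights (1a).** A relaxed layered template with arithmetic heights `z m = h m + c` is
the Barlow stacking `barlowStacking a h s` translated by `c e₃`, point by point. -/
theorem layeredPos_uniform (a h c : ℝ) (s : ℤ → ℤ) (m i j : ℤ) :
    layeredPos a s (fun m => h * m + c) m i j = barlowPos a h s m i j + c • layerNormal 1 := by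
  simp only [layeredPos, barlowPos]
  ext l; fin_cases l <;> simp [layerNormal, triangularVec₁, triangularVec₂, barlowOffset]; ring

/-- **Uniform heights (1a), set form.** The layered set with arithmetic heights is the translate by
`c e₃` of `barlowStacking a h s`. -/
theorem layeredSet_uniform_eq (a h c : ℝ) (s : ℤ → ℤ) :
    {p : EuclideanSpace ℝ (Fin 3) | ∃ m i j : ℤ, p = layeredPos a s (fun m => h * m + c) m i j} =
      (fun p => p + c • layerNormal 1) '' barlowStacking a h s := by
  ext p
  simp only [Set.mem_setOf_eq, Set.mem_image, mem_barlowStacking_iff, layeredPos_uniform]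
  constructor
  · rintro ⟨m, i, j, rfl⟩
    exact ⟨_, ⟨m, i, j, rfl⟩, rfl⟩
  · rintro ⟨_, ⟨m, i, j, rfl⟩, rfl⟩
    exact ⟨m, i, j, rfl⟩

/-- Relaxed offset = uniform offset + (height deviation from the progression of step `h`) `e₃`. -/
theorem layeredPos_sub (a h : ℝ) (s : ℤ → ℤ) (z : ℤ → ℝ) (m i j m₀ i₀ j₀ : ℤ) :
    layeredPos a s z m i j - layeredPos a s z m₀ i₀ j₀ =
      (barlowPos a h s m i j - barlowPos a h s m₀ i₀ j₀) +
        (z m - z m₀ - ((m : ℝ) - m₀) * h) • layerNormal 1 := by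
  simp only [layeredPos, barlowPos]
  ext l; fin_cases l <;> simp [layerNormal, triangularVec₁, triangularVec₂, barlowOffset]; ring

/-- The relaxed and the uniform offsets of the template point `(m, i, j)` differ in norm by exactly
the height deviation `|z m - z m₀ - (m - m₀) h|`. -/
theorem norm_layeredPos_sub_sub (a h : ℝ) (s : ℤ → ℤ) (z : ℤ → ℝ) (m i j m₀ i₀ j₀ : ℤ) :
    ‖(layeredPos a s z m i j - layeredPos a s z m₀ i₀ j₀) -
        (barlowPos a h s m i j - barlowPos a h s m₀ i₀ j₀)‖ = |z m - z m₀ - ((m : ℝ) - m₀) * h| := by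
  rw [layeredPos_sub a h, add_sub_cancel_left, LayeredHull.cake_smul_layerNormal_one, norm_layerNormal]

/-- The height difference is bounded by the norm of the relaxed offset. -/
theorem abs_sub_le_norm_layeredPos_sub (a : ℝ) (s : ℤ → ℤ) (z : ℤ → ℝ) (m i j m₀ i₀ j₀ : ℤ) :
    |z m - z m₀| ≤ ‖layeredPos a s z m i j - layeredPos a s z m₀ i₀ j₀‖ := by
  have := PiLp.norm_apply_le (layeredPos a s z m i j - layeredPos a s z m₀ i₀ j₀) 2
  simpa using this

/-- `|(m - m₀) h|` is bounded by the distance of the Barlow points. -/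
theorem abs_sub_mul_le_dist_barlowPos (a h : ℝ) (s : ℤ → ℤ) (m i j m₀ i₀ j₀ : ℤ) :
    |((m : ℝ) - m₀) * h| ≤ dist (barlowPos a h s m i j) (barlowPos a h s m₀ i₀ j₀) := by
  have := PiLp.dist_apply_le (barlowPos a h s m i j) (barlowPos a h s m₀ i₀ j₀) 2
  rwa [barlowPos_apply_two, barlowPos_apply_two, Real.dist_eq, ← sub_mul] at this

/-- Increments `≥ c` integrate: `c (m - m₀) ≤ z m - z m₀` for `m₀ ≤ m`. -/
theorem increments_lower {z : ℤ → ℝ} {c : ℝ} (hz : ∀ m, c ≤ z (m + 1) - z m) {m₀ m : ℤ}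
    (hle : m₀ ≤ m) : c * ((m : ℝ) - m₀) ≤ z m - z m₀ := by
  induction m, hle using Int.leInduction with
  | base => simp
  | succ m hle ih => have := hz m; push_cast; linarith

/-- Increments `≥ c` integrate: `c |m - m₀| ≤ |z m - z m₀|`. -/
theorem mul_abs_le_abs_sub {z : ℤ → ℝ} {c : ℝ} (hz : ∀ m, c ≤ z (m + 1) - z m) (m m₀ : ℤ) :
    c * |(m : ℝ) - m₀| ≤ |z m - z m₀| := by
  rcases le_total m₀ m with hle | hle
  · have h1 := increments_lower hz hle
    have h0 : (0 : ℝ) ≤ (m : ℝ) - m₀ := by exact_mod_cast sub_nonneg.2 hle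
    rw [abs_of_nonneg h0]
    exact h1.trans (le_abs_self _)
  · have h1 := increments_lower hz hle
    have h0 : (m : ℝ) - m₀ ≤ 0 := by exact_mod_cast sub_nonpos.2 hle
    rw [abs_of_nonpos h0, neg_sub]
    exact h1.trans ((le_abs_self _).trans_eq (abs_sub_comm _ _))

/-! ## §2 Per-site transfer (deterministic; no minimality) -/

/-- **Uniform heights ⇒ Barlow-matched at the SAME `(R, ε)`** (sanity inclusion (1a)): if the
`R`-window of `x i` is two-way `ε`-matched to a relaxed layered template whose heights are EXACTLY
arithmetic, `z m = h m + c` with `h ∈ [39a/50, 17a/20]`, `a ∈ [47/50, 1]`, then it is two-way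
`ε`-matched to the Barlow stacking `barlowStacking a h s` (same `a`, `s`, `A`; `a, h ∈ (1/2, 2)`). -/
theorem barlowMatched_of_uniform {N : ℕ} {x : Fin N → EuclideanSpace ℝ (Fin 3)} {i : Fin N}
    {R ε a h c : ℝ} {s : ℤ → ℤ} {m₀ i₀ j₀ : ℤ} {A : EuclideanSpace ℝ (Fin 3) →ₗᵢ[ℝ] EuclideanSpace ℝ (Fin 3)}
    (ha : 47 / 50 ≤ a) (ha1 : a ≤ 1) (hs : IsHaggSeq s)
    (hh : 39 / 50 * a ≤ h) (hh' : h ≤ 17 / 20 * a)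
    (h1 : ∀ m i' j' : ℤ, dist (layeredPos a s (fun m => h * m + c) m i' j')
        (layeredPos a s (fun m => h * m + c) m₀ i₀ j₀) ≤ R →
      ∃ j : Fin N, dist (x j) (x i + A (layeredPos a s (fun m => h * m + c) m i' j' -
        layeredPos a s (fun m => h * m + c) m₀ i₀ j₀)) ≤ ε)
    (h2 : ∀ j : Fin N, dist (x j) (x i) ≤ R → ∃ m i' j' : ℤ,
      dist (x j) (x i + A (layeredPos a s (fun m => h * m + c) m i' j' -
        layeredPos a s (fun m => h * m + c) m₀ i₀ j₀)) ≤ ε) :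
    ∃ a h : ℝ, 1 / 2 < a ∧ a < 2 ∧ 1 / 2 < h ∧ h < 2 ∧ ∃ s : ℤ → ℤ, IsHaggSeq s ∧
      ∃ z ∈ barlowStacking a h s, ∃ A : EuclideanSpace ℝ (Fin 3) →ₗᵢ[ℝ] EuclideanSpace ℝ (Fin 3),
        (∀ p ∈ barlowStacking a h s, dist p z ≤ R →
          ∃ j : Fin N, dist (x j) (x i + A (p - z)) ≤ ε) ∧
        (∀ j : Fin N, dist (x j) (x i) ≤ R →
          ∃ p ∈ barlowStacking a h s, dist (x j) (x i + A (p - z)) ≤ ε) := by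
  have e : ∀ m i' j' : ℤ, layeredPos a s (fun m => h * m + c) m i' j' -
      layeredPos a s (fun m => h * m + c) m₀ i₀ j₀ =
        barlowPos a h s m i' j' - barlowPos a h s m₀ i₀ j₀ := by
    intro m i' j'
    rw [layeredPos_uniform, layeredPos_uniform, add_sub_add_right_eq_sub]
  refine ⟨a, h, by linarith, by linarith, by linarith, by linarith, s, hs, barlowPos a h s m₀ i₀ j₀,
    barlowPos_mem _ _ _, A, ?_, ?_⟩
  · rintro p ⟨m, i', j', rfl⟩ hpR
    have := h1 m i' j' (by rwa [dist_eq_norm, e, ← dist_eq_norm])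
    rwa [e] at this
  · intro j hjR
    obtain ⟨m, i', j', hm⟩ := h2 j hjR
    exact ⟨barlowPos a h s m i' j', barlowPos_mem _ _ _, by rwa [e] at hm⟩

/-- **Near-uniform ⇒ uniform (per site, deterministic).**  If the `R₁`-window of `x i` is two-way
`ε₁`-matched (after the linear isometry `A`) to the `R₁`-window of the point `(m₀, i₀, j₀)` of a
relaxed layered template `layeredPos a s z` whose heights are `δ`-close to an arithmetic
progression of step `h ∈ (1/2, 2)` on the layers `|m - m₀| ≤ 2 R₁`, then the `R`-window of `x i`
(`R + ε₁ + δ ≤ R₁`) is two-way `(ε₁ + δ)`-matched, after the same `A`, to the `R`-window of the point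
`barlowPos a h s m₀ i₀ j₀` of the UNIFORM-gap Barlow stacking `barlowStacking a h s`. -/
theorem barlowMatched_of_nearUniform {N : ℕ} {x : Fin N → EuclideanSpace ℝ (Fin 3)} {i : Fin N}
    {R R₁ ε₁ δ a h : ℝ} {s : ℤ → ℤ} {z : ℤ → ℝ} {m₀ i₀ j₀ : ℤ} {A : EuclideanSpace ℝ (Fin 3) →ₗᵢ[ℝ] EuclideanSpace ℝ (Fin 3)}
    (ha : 47 / 50 ≤ a) (ha1 : a ≤ 1) (hs : IsHaggSeq s)
    (hz : ∀ m : ℤ, 39 / 50 * a ≤ z (m + 1) - z m ∧ z (m + 1) - z m ≤ 17 / 20 * a)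
    (hh : 1 / 2 < h) (hh2 : h < 2) (hε₁ : 0 ≤ ε₁) (hδ : 0 ≤ δ)
    (hR₁ : R + ε₁ + δ ≤ R₁)
    (hunif : ∀ m : ℤ, |(m : ℝ) - m₀| ≤ 2 * R₁ → |z m - z m₀ - ((m : ℝ) - m₀) * h| ≤ δ)
    (h1 : ∀ m i' j' : ℤ, dist (layeredPos a s z m i' j') (layeredPos a s z m₀ i₀ j₀) ≤ R₁ →
      ∃ j : Fin N, dist (x j) (x i + A (layeredPos a s z m i' j' - layeredPos a s z m₀ i₀ j₀)) ≤ ε₁)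
    (h2 : ∀ j : Fin N, dist (x j) (x i) ≤ R₁ → ∃ m i' j' : ℤ,
      dist (x j) (x i + A (layeredPos a s z m i' j' - layeredPos a s z m₀ i₀ j₀)) ≤ ε₁) :
    ∃ a h : ℝ, 1 / 2 < a ∧ a < 2 ∧ 1 / 2 < h ∧ h < 2 ∧ ∃ s : ℤ → ℤ, IsHaggSeq s ∧
      ∃ z ∈ barlowStacking a h s, ∃ A : EuclideanSpace ℝ (Fin 3) →ₗᵢ[ℝ] EuclideanSpace ℝ (Fin 3),
        (∀ p ∈ barlowStacking a h s, dist p z ≤ R →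
          ∃ j : Fin N, dist (x j) (x i + A (p - z)) ≤ ε₁ + δ) ∧
        (∀ j : Fin N, dist (x j) (x i) ≤ R →
          ∃ p ∈ barlowStacking a h s, dist (x j) (x i + A (p - z)) ≤ ε₁ + δ) := by
  -- for a layer `m` in range, the relaxed and the uniform offsets differ by at most `δ`
  have key : ∀ m i' j' : ℤ, |(m : ℝ) - m₀| ≤ 2 * R₁ →
      dist (x i + A (layeredPos a s z m i' j' - layeredPos a s z m₀ i₀ j₀))
        (x i + A (barlowPos a h s m i' j' - barlowPos a h s m₀ i₀ j₀)) ≤ δ := by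
    intro m i' j' hm
    rw [dist_eq_norm, add_sub_add_left_eq_sub, ← map_sub, LinearIsometry.norm_map,
      norm_layeredPos_sub_sub]
    exact hunif m hm
  refine ⟨a, h, by linarith, by linarith, hh, hh2, s, hs, barlowPos a h s m₀ i₀ j₀,
    barlowPos_mem _ _ _, A, ?_, ?_⟩
  · rintro p ⟨m, i', j', rfl⟩ hpR
    -- the layer index is in range: `|(m - m₀) h| ≤ R` and `h > 1/2`
    have hm : |(m : ℝ) - m₀| ≤ 2 * R₁ := by
      have h3 := (abs_sub_mul_le_dist_barlowPos a h s m i' j' m₀ i₀ j₀).trans hpR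
      rw [abs_mul, abs_of_pos (by linarith : (0 : ℝ) < h)] at h3
      have : |(m : ℝ) - m₀| * (1 / 2) ≤ |(m : ℝ) - m₀| * h :=
        mul_le_mul_of_nonneg_left hh.le (abs_nonneg _)
      linarith
    -- the relaxed template point lies in the `R₁`-window
    have hwin : dist (layeredPos a s z m i' j') (layeredPos a s z m₀ i₀ j₀) ≤ R₁ := by
      have t := norm_sub_norm_le (layeredPos a s z m i' j' - layeredPos a s z m₀ i₀ j₀)
        (barlowPos a h s m i' j' - barlowPos a h s m₀ i₀ j₀)
      rw [norm_layeredPos_sub_sub, ← dist_eq_norm, ← dist_eq_norm] at t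
      linarith [hunif m hm]
    obtain ⟨j, hj⟩ := h1 m i' j' hwin
    exact ⟨j, (dist_triangle _ _ _).trans (add_le_add hj (key m i' j' hm))⟩
  · intro j hjR
    obtain ⟨m, i', j', hm⟩ := h2 j (by linarith)
    -- the matched relaxed offset has norm `≤ R + ε₁`, so its layer index is in range
    have hnorm : ‖layeredPos a s z m i' j' - layeredPos a s z m₀ i₀ j₀‖ ≤ R + ε₁ := by
      have e1 : ‖layeredPos a s z m i' j' - layeredPos a s z m₀ i₀ j₀‖ =
          dist (x i + A (layeredPos a s z m i' j' - layeredPos a s z m₀ i₀ j₀)) (x i) := by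
        rw [dist_eq_norm, add_sub_cancel_left, LinearIsometry.norm_map]
      rw [e1]
      have := dist_triangle (x i + A (layeredPos a s z m i' j' - layeredPos a s z m₀ i₀ j₀))
        (x j) (x i)
      rw [dist_comm] at hm
      linarith
    have hm_range : |(m : ℝ) - m₀| ≤ 2 * R₁ := by
      have hc := mul_abs_le_abs_sub (fun m => (hz m).1) m m₀
      have h3 := (abs_sub_le_norm_layeredPos_sub a s z m i' j' m₀ i₀ j₀).trans hnorm
      have : (1 / 2 : ℝ) * |(m : ℝ) - m₀| ≤ 39 / 50 * a * |(m : ℝ) - m₀| :=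
        mul_le_mul_of_nonneg_right (by linarith) (abs_nonneg _)
      linarith
    exact ⟨barlowPos a h s m i' j', barlowPos_mem _ _ _,
      (dist_triangle _ _ _).trans (add_le_add hm (key m i' j' hm_range))⟩

/-! ### Interface to the energetic side: near-constant increments ⇒ near-arithmetic heights -/

/-- If the increments `z (m+1) - z m` are `η`-close to a common value `h` for the layers
`|m - m₀| ≤ K`, then the heights are `|m - m₀| η`-close (hence `K η`-close) to the arithmetic
progression `z m₀ + (m - m₀) h` on those layers.  (So the residual predicate of §3 at `(R, ε, δ)`
follows from "all increments of the matched template within `2R + 1` layers of the base layer agree to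
`δ / (2R + 1)`", the form in which increment convexity — `LayeredHull.stub_convexity`, `clo_partB` of
stmt-11779 — delivers gap uniformity.) -/
theorem abs_sub_arith_le_of_increments {z : ℤ → ℝ} {m₀ : ℤ} {K η h : ℝ}
    (hinc : ∀ m : ℤ, |(m : ℝ) - m₀| ≤ K → |z (m + 1) - z m - h| ≤ η) :
    ∀ m : ℤ, |(m : ℝ) - m₀| ≤ K → |z m - z m₀ - ((m : ℝ) - m₀) * h| ≤ |(m : ℝ) - m₀| * η := by
  -- upwards
  have up : ∀ n : ℕ, ((n : ℝ) ≤ K) →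
      |z (m₀ + n) - z m₀ - (n : ℝ) * h| ≤ (n : ℝ) * η := by
    intro n
    induction n with
    | zero => intro _; simp
    | succ n ih =>
      intro hn
      push_cast at hn ⊢
      have ih' := ih (by linarith)
      have hstep := hinc (m₀ + n) (by
        push_cast; rw [add_sub_cancel_left, abs_of_nonneg (Nat.cast_nonneg n)]; linarith)
      have e : z (m₀ + (n + 1)) - z m₀ - (n + 1) * h =
          (z (m₀ + n + 1) - z (m₀ + n) - h) + (z (m₀ + n) - z m₀ - n * h) := by
        rw [add_assoc]; ring
      rw [e]
      calc |(z (m₀ + n + 1) - z (m₀ + n) - h) + (z (m₀ + n) - z m₀ - n * h)|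
          ≤ |z (m₀ + n + 1) - z (m₀ + n) - h| + |z (m₀ + n) - z m₀ - n * h| := abs_add_le _ _
        _ ≤ η + n * η := add_le_add hstep ih'
        _ = (n + 1) * η := by ring
  -- downwards
  have down : ∀ n : ℕ, ((n : ℝ) ≤ K) →
      |z (m₀ - n) - z m₀ - (-(n : ℝ)) * h| ≤ (n : ℝ) * η := by
    intro n
    induction n with
    | zero => intro _; simp
    | succ n ih =>
      intro hn
      push_cast at hn ⊢
      have ih' := ih (by linarith)
      have hstep := hinc (m₀ - (n + 1)) (by
        push_cast
        rw [show (m₀ : ℝ) - (n + 1) - m₀ = -((n : ℝ) + 1) by ring, abs_neg,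
          abs_of_nonneg (by positivity)]
        exact hn)
      have e : z (m₀ - (n + 1)) - z m₀ - (-((n : ℝ) + 1)) * h =
          -(z (m₀ - (n + 1) + 1) - z (m₀ - (n + 1)) - h) + (z (m₀ - n) - z m₀ - (-(n : ℝ)) * h) := by
        rw [show m₀ - ((n : ℤ) + 1) + 1 = m₀ - n by ring]; ring
      rw [e]
      calc |-(z (m₀ - (n + 1) + 1) - z (m₀ - (n + 1)) - h) + (z (m₀ - n) - z m₀ - (-(n : ℝ)) * h)|
          ≤ |-(z (m₀ - (n + 1) + 1) - z (m₀ - (n + 1)) - h)| + |z (m₀ - n) - z m₀ - (-(n : ℝ)) * h| :=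
            abs_add_le _ _
        _ ≤ η + n * η := by rw [abs_neg]; exact add_le_add hstep ih'
        _ = (n + 1) * η := by ring
  intro m hm
  rcases le_total m₀ m with hle | hle
  · obtain ⟨n, rfl⟩ : ∃ n : ℕ, m = m₀ + n := ⟨(m - m₀).toNat, by omega⟩
    have hn : |((m₀ + n : ℤ) : ℝ) - m₀| = n := by
      push_cast; rw [add_sub_cancel_left, abs_of_nonneg (Nat.cast_nonneg n)]
    rw [hn] at hm ⊢
    have := up n hm
    push_cast at this ⊢
    rwa [add_sub_cancel_left]
  · obtain ⟨n, rfl⟩ : ∃ n : ℕ, m = m₀ - n := ⟨(m₀ - m).toNat, by omega⟩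
    have hn : |((m₀ - n : ℤ) : ℝ) - m₀| = n := by
      push_cast
      rw [show (m₀ : ℝ) - n - m₀ = -(n : ℝ) by ring, abs_neg, abs_of_nonneg (Nat.cast_nonneg n)]
    rw [hn] at hm ⊢
    have := down n hm
    push_cast at this ⊢
    rwa [show (m₀ : ℝ) - n - m₀ = -(n : ℝ) by ring]

/-! ## §3 A.e. transfer and the reduction of the stub to the energetic residual -/

/-- **Per-site transfer at the stub's parameters.**  If the `(R + 1)`-window of `x i` is two-way
`ε/2`-matched to a relaxed layered template whose heights are `ε/2`-close to an arithmetic progression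
on the layers `|m - m₀| ≤ 2 (R + 1)` (`0 ≤ R`, `0 < ε < 1/4`), then `x i` is Barlow-matched at
`(R, ε)` (the conclusion predicate of the crux, verbatim).  The fitted step is automatically in
`(1/2, 2)`: the first increment lies in `[39a/50, 17a/20] ⊆ [0.733, 0.85]` and `ε/2 < 1/8`. -/
theorem nearUniform_imp_barlowMatched {N : ℕ} {R ε : ℝ} {x : Fin N → EuclideanSpace ℝ (Fin 3)}
    {i : Fin N} (hR : 0 ≤ R) (hε : 0 < ε) (hε' : ε < 1 / 4)
    (hNU : ∃ a : ℝ, 47 / 50 ≤ a ∧ a ≤ 1 ∧ ∃ s : ℤ → ℤ, IsHaggSeq s ∧ ∃ z : ℤ → ℝ,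
      (∀ m : ℤ, 39 / 50 * a ≤ z (m + 1) - z m ∧ z (m + 1) - z m ≤ 17 / 20 * a) ∧
      ∃ m₀ i₀ j₀ : ℤ, ∃ A : EuclideanSpace ℝ (Fin 3) →ₗᵢ[ℝ] EuclideanSpace ℝ (Fin 3),
        (∃ h : ℝ, ∀ m : ℤ, |(m : ℝ) - m₀| ≤ 2 * (R + 1) →
          |z m - z m₀ - ((m : ℝ) - m₀) * h| ≤ ε / 2) ∧
        (∀ m i' j' : ℤ, dist (layeredPos a s z m i' j') (layeredPos a s z m₀ i₀ j₀) ≤ R + 1 →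
          ∃ j : Fin N, dist (x j) (x i + A (layeredPos a s z m i' j' - layeredPos a s z m₀ i₀ j₀)) ≤ ε / 2) ∧
        (∀ j : Fin N, dist (x j) (x i) ≤ R + 1 → ∃ m i' j' : ℤ,
          dist (x j) (x i + A (layeredPos a s z m i' j' - layeredPos a s z m₀ i₀ j₀)) ≤ ε / 2)) :
    ∃ a h : ℝ, 1 / 2 < a ∧ a < 2 ∧ 1 / 2 < h ∧ h < 2 ∧ ∃ s : ℤ → ℤ, IsHaggSeq s ∧
      ∃ z ∈ barlowStacking a h s, ∃ A : EuclideanSpace ℝ (Fin 3) →ₗᵢ[ℝ] EuclideanSpace ℝ (Fin 3),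
        (∀ p ∈ barlowStacking a h s, dist p z ≤ R → ∃ j : Fin N, dist (x j) (x i + A (p - z)) ≤ ε) ∧
        (∀ j : Fin N, dist (x j) (x i) ≤ R →
          ∃ p ∈ barlowStacking a h s, dist (x j) (x i + A (p - z)) ≤ ε) := by
  obtain ⟨a, ha, ha1, s, hs, z, hz, m₀, i₀, j₀, A, ⟨h, hunif⟩, h1, h2⟩ := hNU
  -- the fitted step is close to the first increment
  have hfirst := hunif (m₀ + 1) (by push_cast; rw [add_sub_cancel_left, abs_one]; linarith)
  have hz0 := hz m₀
  push_cast at hfirst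
  rw [add_sub_cancel_left, one_mul] at hfirst
  have hh : 1 / 2 < h := by have := (abs_le.1 hfirst).2; linarith
  have hh2 : h < 2 := by have := (abs_le.1 hfirst).1; linarith
  have key := barlowMatched_of_nearUniform (R := R) ha ha1 hs hz hh hh2 (by linarith) (by linarith)
    (by linarith) hunif h1 h2
  rwa [add_halves] at key

/-- **A.e. transfer** (counting only, no minimality): along any sequence of configurations, if for
every `R > 0`, `ε > 0`, `δ > 0` a.e. site is relaxed-matched at `(R, ε)` by a template with heights
`δ`-close to arithmetic on the layers `|m - m₀| ≤ 2R`, then for every `R > 0`, `ε ∈ (0, 1/4)` a.e. site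
is Barlow-matched at `(R, ε)` (pointwise inclusion at `(R + 1, ε/2, ε/2)` and `squeeze_zero`). -/
theorem tendsto_barlowMatched_of_nearUniform (x : (N : ℕ) → (Fin N → EuclideanSpace ℝ (Fin 3)))
    (hNU : ∀ R ε δ : ℝ, 0 < R → 0 < ε → 0 < δ →
      Filter.Tendsto (fun N : ℕ => (Nat.card {i : Fin N // ¬ (∃ a : ℝ, 47 / 50 ≤ a ∧ a ≤ 1 ∧
        ∃ s : ℤ → ℤ, IsHaggSeq s ∧ ∃ z : ℤ → ℝ,
          (∀ m : ℤ, 39 / 50 * a ≤ z (m + 1) - z m ∧ z (m + 1) - z m ≤ 17 / 20 * a) ∧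
          ∃ m₀ i₀ j₀ : ℤ, ∃ A : EuclideanSpace ℝ (Fin 3) →ₗᵢ[ℝ] EuclideanSpace ℝ (Fin 3),
            (∃ h : ℝ, ∀ m : ℤ, |(m : ℝ) - m₀| ≤ 2 * R → |z m - z m₀ - ((m : ℝ) - m₀) * h| ≤ δ) ∧
            (∀ m i' j' : ℤ, dist (layeredPos a s z m i' j') (layeredPos a s z m₀ i₀ j₀) ≤ R →
              ∃ j : Fin N, dist (x N j) (x N i + A (layeredPos a s z m i' j' - layeredPos a s z m₀ i₀ j₀)) ≤ ε) ∧
            (∀ j : Fin N, dist (x N j) (x N i) ≤ R → ∃ m i' j' : ℤ,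
              dist (x N j) (x N i + A (layeredPos a s z m i' j' - layeredPos a s z m₀ i₀ j₀)) ≤ ε))} : ℝ) / N)
        Filter.atTop (nhds 0))
    (R ε : ℝ) (hR : 0 < R) (hε : 0 < ε) (hε' : ε < 1 / 4) :
    Filter.Tendsto (fun N : ℕ => (Nat.card {i : Fin N // ¬ (∃ a h : ℝ, 1 / 2 < a ∧ a < 2 ∧ 1 / 2 < h ∧ h < 2 ∧
      ∃ s : ℤ → ℤ, IsHaggSeq s ∧ ∃ z ∈ barlowStacking a h s,
        ∃ A : EuclideanSpace ℝ (Fin 3) →ₗᵢ[ℝ] EuclideanSpace ℝ (Fin 3),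
          (∀ p ∈ barlowStacking a h s, dist p z ≤ R → ∃ j : Fin N, dist (x N j) (x N i + A (p - z)) ≤ ε) ∧
          (∀ j : Fin N, dist (x N j) (x N i) ≤ R →
            ∃ p ∈ barlowStacking a h s, dist (x N j) (x N i + A (p - z)) ≤ ε))} : ℝ) / N)
      Filter.atTop (nhds 0) := by
  classical
  have hT := hNU (R + 1) (ε / 2) (ε / 2) (by linarith) (by linarith) (by linarith)
  refine squeeze_zero (fun N => by positivity) (fun N => ?_) hT
  refine div_le_div_of_nonneg_right ?_ (Nat.cast_nonneg N)
  rw [Nat.cast_le, Nat.card_eq_fintype_card, Nat.card_eq_fintype_card]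
  exact Fintype.card_subtype_mono _ _ fun i hi hNUi =>
    hi (nearUniform_imp_barlowMatched hR.le hε hε' hNUi)

/-- **Registered closed form** of `tendsto_barlowMatched_of_nearUniform` (the deterministic
transfer of `stub_uniformSpacing`): a.e. relaxed-matched with near-uniform heights at every
`(R, ε, δ)` ⇒ a.e. Barlow-matched at every `(R, ε)`. -/
theorem stub_nearUniformTransfer :
    ∀ x : (N : ℕ) → (Fin N → EuclideanSpace ℝ (Fin 3)),
      (∀ R ε δ : ℝ, 0 < R → 0 < ε → 0 < δ →
        Filter.Tendsto (fun N : ℕ => (Nat.card {i : Fin N // ¬ (∃ a : ℝ, 47 / 50 ≤ a ∧ a ≤ 1 ∧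
          ∃ s : ℤ → ℤ, IsHaggSeq s ∧ ∃ z : ℤ → ℝ,
            (∀ m : ℤ, 39 / 50 * a ≤ z (m + 1) - z m ∧ z (m + 1) - z m ≤ 17 / 20 * a) ∧
            ∃ m₀ i₀ j₀ : ℤ, ∃ A : EuclideanSpace ℝ (Fin 3) →ₗᵢ[ℝ] EuclideanSpace ℝ (Fin 3),
              (∃ h : ℝ, ∀ m : ℤ, |(m : ℝ) - m₀| ≤ 2 * R → |z m - z m₀ - ((m : ℝ) - m₀) * h| ≤ δ) ∧
              (∀ m i' j' : ℤ, dist (layeredPos a s z m i' j') (layeredPos a s z m₀ i₀ j₀) ≤ R →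
                ∃ j : Fin N, dist (x N j) (x N i + A (layeredPos a s z m i' j' - layeredPos a s z m₀ i₀ j₀)) ≤ ε) ∧
              (∀ j : Fin N, dist (x N j) (x N i) ≤ R → ∃ m i' j' : ℤ,
                dist (x N j) (x N i + A (layeredPos a s z m i' j' - layeredPos a s z m₀ i₀ j₀)) ≤ ε))} : ℝ) / N)
          Filter.atTop (nhds 0)) →
      ∀ R ε : ℝ, 0 < R → 0 < ε → ε < 1 / 4 →
        Filter.Tendsto (fun N : ℕ => (Nat.card {i : Fin N // ¬ (∃ a h : ℝ, 1 / 2 < a ∧ a < 2 ∧ 1 / 2 < h ∧ h < 2 ∧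
          ∃ s : ℤ → ℤ, IsHaggSeq s ∧ ∃ z ∈ barlowStacking a h s,
            ∃ A : EuclideanSpace ℝ (Fin 3) →ₗᵢ[ℝ] EuclideanSpace ℝ (Fin 3),
              (∀ p ∈ barlowStacking a h s, dist p z ≤ R → ∃ j : Fin N, dist (x N j) (x N i + A (p - z)) ≤ ε) ∧
              (∀ j : Fin N, dist (x N j) (x N i) ≤ R →
                ∃ p ∈ barlowStacking a h s, dist (x N j) (x N i + A (p - z)) ≤ ε))} : ℝ) / N)
          Filter.atTop (nhds 0) :=
  tendsto_barlowMatched_of_nearUniform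

end Summit.AtomisticToContinuum.Crystallization.Theorems.SquareWellLayerCakeGapTwelveToBarlow

end
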